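import Literature.NumberTheory.Automorphic.ShimuraCurveDataExistence
import Literature.NumberTheory.Automorphic.QuaternionDiscriminantIndex
import Literature.NumberTheory.Automorphic.QuaternionInvolutionToolkit
import Literature.NumberTheory.Automorphic.BrandtModuleDictionary
import Mathlib.LinearAlgebra.Matrix.StdBasis
import HarnessLib

/-!
# The covolume of `ι(O)` in `M₂(ℝ)` for a Shimura curve datum of level `(D, M)`, `D > 1`:
# `covol ι(O) = D · M` (Vignéras, LNM 800, Ch. I §4 Lemme 4.7, Ch. III §5 Cor. 5.3, Ch. IV §1)

Topic `NumberTheory/Automorphic`; theorems only (no definition, no named fact, no instance).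
For a Shimura curve datum `X : ShimuraCurveData D M` (`ShimuraCurve.lean`: `B/ℚ` ramified exactly
at the primes dividing the squarefree `D`, `O` an Eichler order of level `M`, `ι : B → M₂(ℝ)`
an injective real splitting) with `1 < D` (so that `B` is a division algebra,
`ShimuraCurveData.isUnit_of_ne_zero`) and `0 < M`, and ANY `ℤ`-basis `b` of `O` indexed by the
matrix positions `Fin 2 × Fin 2`, the `4 × 4` real matrix of entries `P i k = ι(b i)_k` has
(the division hypothesis is `ShimuraCurveData.isUnit_of_ne_zero` of `ShimuraCurveDivisionLattice.lean`
for `1 < D`; it is taken here as the hypothesis `hdiv`)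

  `|det P| = D · M`   (`ShimuraCurveData.abs_det_entries_eq`),

i.e. the `ℤ`-lattice `ι(O) ⊆ M₂(ℝ) ≅ ℝ⁴` has covolume `D M` for the Lebesgue measure of the four
entries (the normalisation in which `M₂(ℤ)` has covolume `1`). This is the "reduced discriminant
`d(O) = D M`" of an Eichler order of level `M` (Vignéras III §5, after Cor. 5.3) read through the
trace form: brick "S3c" of the `D > 1` branch of the proof of
`Literature.NumberTheory.Automorphic.ShimuraCurveData.volume_fd_eq` (Eichler's lattice-point
method divides a cone volume by this covolume).

Proof.
1. `nondegenerate_trace_conj_of_isQuaternionAlgebra` — the trace form `T(x, y) = trd(x ȳ)` of a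
   quaternion algebra over `ℚ` is nondegenerate (from the tree's nondegeneracy of `trd(x y)`).
2. `relIndex_dual_eq_sq_of_forall_isUnit` — **`[O₁♯ : O₁] = D²`** for a maximal order `O₁` of a
   DIVISION quaternion algebra ramified exactly at `p ∣ D` (`D` squarefree): the tree's
   `relIndex_dual_eq_sq` (`QuaternionDiscriminantIndex.lean`) verbatim, its hypothesis "totally
   definite" being used there only to get a division algebra and the nondegeneracy of `T`
   (Vignéras I §4 Lemme 4.7, II §1 Cor. 1.7, §2, III §5 Cor. 5.3: locally the index is `p²` at a
   ramified prime and `1` at a split one).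
3. `abs_det_traceMatrix_eq_of_isEichlerOrder` — for an Eichler order `O = O₁ ∩ O₂` of level `M`
   and a `ℤ`-basis `b` of `O`: `|det (trd(b_i b̄_j))| = (D M)²` (Gram determinant = index,
   `cast_relIndex_dualSubmodule_eq_abs_det`, and the change of basis `O ⊆ O₁` of determinant
   `±M`, Mathlib `AddSubgroup.relIndex_eq_abs_det`, `BilinForm.toMatrix_mul_basis_toMatrix`).
4. The real side: on `M₂(ℝ)` the bilinear form `β(X, Y) = tr X · tr Y - tr(X Y) = tr(X · adj Y)`
   has, in the basis of matrix units, a Gram matrix `G₀` with `G₀² = 1`; and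
   `β(ι x, ι y) = trd(x ȳ)` (`AlgHom.trace_eq_reducedTrace`, `ȳ = trd(y) - y`). Hence
   `det(P)² · det G₀ = det (trd(b_i b̄_j))`, `|det P|² = (D M)²`.

## References

* M.-F. Vignéras, *Arithmétique des algèbres de quaternions*, LNM 800 (1980), Ch. I §4
  Lemme 4.7; Ch. II §1 Cor. 1.7, §2; Ch. III §5 Cor. 5.3; Ch. IV §1 [VignerasLNM800].
* J. Voight, *Quaternion Algebras*, GTM 288 (2021), §15.2, 15.6, 23.4.
-/

noncomputable section

open scoped Pointwise TensorProduct
open NumberField IsDedekindDomain Module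

universe u

namespace Literature.NumberTheory.Automorphic

variable {B : Type u} [Ring B] [Algebra ℚ B] [IsQuaternionAlgebra ℚ B]

/-! ### 1. The trace form `trd(x ȳ)` is nondegenerate -/

/-- **The trace form `T(x, y) = trd(x ȳ)` of a quaternion algebra over `ℚ` is nondegenerate**
(from the nondegeneracy of `trd(x y)`, `nondegenerate_mul_compr₂_reducedTrace_of_isQuaternionAlgebra`,
and the bijectivity of `y ↦ ȳ`). [cite: VignerasLNM800, Ch. I §1 Lemme 1.1 and §4 Lemme 4.7] -/
theorem nondegenerate_trace_conj_of_isQuaternionAlgebra (T : LinearMap.BilinForm ℚ B)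
    (hT : ∀ x y, T x y = reducedTrace ℚ B (x * standardInvolution ℚ B y)) : T.Nondegenerate := by
  have hS := nondegenerate_mul_compr₂_reducedTrace_of_isQuaternionAlgebra (D := B)
  have hSapp : ∀ x y : B, ((LinearMap.mul ℚ B).compr₂ (reducedTrace ℚ B)) x y =
      reducedTrace ℚ B (x * y) := fun x y => rfl
  refine ⟨fun x hx => hS.1 x fun y => ?_, fun y hy => ?_⟩
  · have := hx (standardInvolution ℚ B y)
    rw [hT, standardInvolution_standardInvolution ℚ] at this
    rw [hSapp]
    exact this
  · have h1 : standardInvolution ℚ B y = 0 := hS.2 _ fun x => by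
      rw [hSapp, ← hT]
      exact hy x
    rw [← standardInvolution_standardInvolution ℚ y, h1, standardInvolution_zero]

/-- The Gram matrix `(trd(b_i b̄_j))` of a `ℤ`-basis of a full lattice has non-zero determinant.
[folklore] -/
theorem det_traceMatrix_ne_zero {ι : Type*} [Fintype ι] [DecidableEq ι] {L : Submodule ℤ B}
    (hL : IsFullLattice B L) (bL : Module.Basis ι ℤ L) :
    (Matrix.of fun i j => reducedTrace ℚ B ((bL i : B) * standardInvolution ℚ B (bL j : B))).det ≠ 0 := by
  classical
  haveI : IsAddTorsionFree B := isAddTorsionFree_of_charZero_module ℚ B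
  haveI := isLocalizedModule_subtype_of_isFullLattice hL
  obtain ⟨T, hT⟩ := exists_bilinForm_trace_conj (B := B)
  have hTnd := nondegenerate_trace_conj_of_isQuaternionAlgebra T hT
  let bQ : Module.Basis ι ℚ B := bL.ofIsLocalizedModule ℚ (nonZeroDivisors ℤ) L.subtype
  have hbQ : ∀ k, bQ k = (bL k : B) := fun k => Module.Basis.ofIsLocalizedModule_apply _ _ _ _ k
  have h := (LinearMap.BilinForm.nondegenerate_iff_det_ne_zero bQ).mp hTnd
  have he : LinearMap.BilinForm.toMatrix bQ T =
      Matrix.of fun i j => reducedTrace ℚ B ((bL i : B) * standardInvolution ℚ B (bL j : B)) := by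
    ext i j
    rw [LinearMap.BilinForm.toMatrix_apply, hT, hbQ, hbQ, Matrix.of_apply]
  rwa [he] at h

/-! ### 2. `[O₁♯ : O₁] = D²` for a maximal order of a division quaternion algebra -/

/-- **The discriminant of a maximal order is `D²`** (division-algebra version of the tree's
`relIndex_dual_eq_sq`, which assumed "totally definite"): for a division quaternion algebra `B`
over `ℚ` ramified exactly at the primes dividing the squarefree `D` and a maximal `ℤ`-order `O₁`,
the dual of `O₁` for `trd(x ȳ)` has index `D²` — locally `p²` at a ramified prime (the dual is
`π⁻¹ O₁,₍ₚ₎`) and `1` at a split one (`M₂(ℤ_p)` is self-dual). [cite: VignerasLNM800, Ch. III §5 Cor. 5.3, Ch. II §1 Cor. 1.7 and §2, Ch. I §4 Lemme 4.7] -/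
theorem relIndex_dual_eq_sq_of_forall_isUnit (hdiv : ∀ x : B, x ≠ 0 → IsUnit x) {D : ℕ}
    (hsq : Squarefree D)
    (hram : ∀ v : HeightOneSpectrum (𝓞 ℚ), v ∈ ramifiedPlaces ℚ B ↔ ((D : ℕ) : 𝓞 ℚ) ∈ v.asIdeal)
    (T : LinearMap.BilinForm ℚ B) (hT : ∀ x y, T x y = reducedTrace ℚ B (x * standardInvolution ℚ B y))
    {O₁ : Submodule ℤ B} (hO₁ : IsMaximalZOrder O₁) :
    O₁.toAddSubgroup.relIndex (T.dualSubmodule O₁).toAddSubgroup = D ^ 2 := by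
  classical
  have hTnd := nondegenerate_trace_conj_of_isQuaternionAlgebra T hT
  have hN0 : D ≠ 0 := hsq.ne_zero
  -- integrality of the trace form on `O₁`
  have hint : ∀ x ∈ O₁, ∀ y ∈ O₁, ∃ n : ℤ, reducedTrace ℚ B (x * standardInvolution ℚ B y) = n := by
    intro x hx y hy
    obtain ⟨t, -, ht, -⟩ := hO₁.1.toIsOrder.exists_int_reducedTrace_reducedNorm
      (hO₁.1.mul_mem _ hx _ (hO₁.1.toIsOrder.standardInvolution_mem hy))
    exact ⟨t, ht⟩
  have hle : O₁ ≤ T.dualSubmodule O₁ := by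
    intro x hx
    rw [LinearMap.BilinForm.mem_dualSubmodule]
    intro y hy
    obtain ⟨n, hn⟩ := hint x hx y hy
    rw [hT, hn, Submodule.mem_one]
    exact ⟨n, by simp⟩
  set n : ℕ := O₁.toAddSubgroup.relIndex (T.dualSubmodule O₁).toAddSubgroup with hn
  -- `n ≠ 0`: the Gram determinant of a nondegenerate form is non-zero
  have hn0 : n ≠ 0 := by
    intro h0
    obtain ⟨bL⟩ := hO₁.1.isFullLattice.nonempty_basis_fin_four
    have hidx := cast_relIndex_dualSubmodule_eq_abs_det T hT hTnd hO₁.1.isFullLattice bL hint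
    rw [← hn, h0, Nat.cast_zero, eq_comm, abs_eq_zero] at hidx
    exact det_traceMatrix_ne_zero hO₁.1.isFullLattice bL hidx
  -- the local indices
  have hloc : ∀ p : ℕ, p.Prime → n.factorization p = (D ^ 2).factorization p := by
    intro p hpp
    haveI : Fact p.Prime := ⟨hpp⟩
    have hrel := relIndex_localAt (T.dualSubmodule O₁) O₁ hle (p := p) hn0
    rw [← hn] at hrel
    have hdual : ∀ x, x ∈ localAt p (T.dualSubmodule O₁) ↔
        ∀ y ∈ localAt p O₁, ¬ p ∣ (reducedTrace ℚ B (x * y)).den :=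
      fun x => (mem_localAt_dualSubmodule_iff T hT hO₁.1.isFullLattice.1 x).trans
        (forall_conj_iff_forall hO₁.1 x)
    rw [Nat.factorization_pow, Finsupp.smul_apply, smul_eq_mul]
    by_cases hpN : p ∣ D
    · -- ramified: the dual is `π⁻¹ O₁,₍ₚ₎`, index `p²`
      have hTdiv := isUnit_padicTensor_of_dvd B hram hpN
      have hΛ : ∀ x : B, x ∈ localAt p O₁ ↔ ¬ p ∣ (reducedNorm ℚ B x).den :=
        fun x => hO₁.mem_localAt_iff_of_ramified hdiv hTdiv x
      obtain ⟨π, -, hπ⟩ := exists_uniformizer_of_ramified hdiv hO₁.1 hΛ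
      have heq : localAt p (T.dualSubmodule O₁) = π⁻¹ • localAt p O₁ := by
        ext x
        rw [hdual, forall_not_dvd_den_reducedTrace_iff_of_ramified hdiv hO₁.1 hΛ hTdiv π hπ x]
      rw [heq, relIndex_localAt_inv_uniformizer_smul hO₁.1 hΛ π hπ] at hrel
      have h2 : D.factorization p = 1 := by
        have h1 := hsq.natFactorization_le_one p
        have h3 := (Nat.Prime.dvd_iff_one_le_factorization hpp hN0).mp hpN
        omega
      rw [h2, mul_one]
      exact (Nat.pow_right_injective hpp.two_le hrel).symm
    · -- split: the dual is `O₁,₍ₚ₎`, index `1`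
      obtain ⟨φ⟩ := exists_algHom_matrix_of_not_dvd hram hpN
      obtain ⟨u, hu⟩ := hO₁.exists_conjUnit_localAt_iff hdiv φ
      have heq : localAt p (T.dualSubmodule O₁) = localAt p O₁ := by
        ext x
        rw [hdual, forall_not_dvd_den_reducedTrace_iff_of_split (AlgHom.conjUnit φ u) hO₁.1 hu x]
      rw [heq, AddSubgroup.relIndex_self] at hrel
      have h2 : D.factorization p = 0 := Nat.factorization_eq_zero_of_not_dvd hpN
      rw [h2, mul_zero]
      have : p ^ 0 = p ^ n.factorization p := by rw [pow_zero]; exact hrel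
      exact (Nat.pow_right_injective hpp.two_le this).symm
  refine Nat.eq_of_factorization_eq hn0 (pow_ne_zero 2 hN0) fun p => ?_
  by_cases hpp : p.Prime
  · exact hloc p hpp
  · rw [Nat.factorization_eq_zero_of_not_prime _ hpp, Nat.factorization_eq_zero_of_not_prime _ hpp]

/-! ### 3. The Gram determinant of an Eichler order: `|det (trd(b_i b̄_j))| = (D M)²` -/

/-- **`|det (trd(b_i b̄_j))| = D²` for a `ℤ`-basis of a maximal order** of a division quaternion
algebra of discriminant `D`. [cite: VignerasLNM800, Ch. III §5 Cor. 5.3 and Ch. I §4 Lemme 4.7] -/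
theorem abs_det_traceMatrix_eq_of_isMaximalZOrder (hdiv : ∀ x : B, x ≠ 0 → IsUnit x) {D : ℕ}
    (hsq : Squarefree D)
    (hram : ∀ v : HeightOneSpectrum (𝓞 ℚ), v ∈ ramifiedPlaces ℚ B ↔ ((D : ℕ) : 𝓞 ℚ) ∈ v.asIdeal)
    {O₁ : Submodule ℤ B} (hO₁ : IsMaximalZOrder O₁) (b₁ : Module.Basis (Fin 4) ℤ O₁) :
    |(Matrix.of fun i j => reducedTrace ℚ B ((b₁ i : B) * standardInvolution ℚ B (b₁ j : B))).det| =
      (D : ℚ) ^ 2 := by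
  obtain ⟨T, hT⟩ := exists_bilinForm_trace_conj (B := B)
  have hTnd := nondegenerate_trace_conj_of_isQuaternionAlgebra T hT
  have hint : ∀ x ∈ O₁, ∀ y ∈ O₁, ∃ n : ℤ, reducedTrace ℚ B (x * standardInvolution ℚ B y) = n := by
    intro x hx y hy
    obtain ⟨t, -, ht, -⟩ := hO₁.1.toIsOrder.exists_int_reducedTrace_reducedNorm
      (hO₁.1.mul_mem _ hx _ (hO₁.1.toIsOrder.standardInvolution_mem hy))
    exact ⟨t, ht⟩
  rw [← cast_relIndex_dualSubmodule_eq_abs_det T hT hTnd hO₁.1.isFullLattice b₁ hint,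
    relIndex_dual_eq_sq_of_forall_isUnit hdiv hsq hram T hT hO₁]
  push_cast
  ring

omit [IsQuaternionAlgebra ℚ B] in
/-- Change of `ℤ`-basis between nested full lattices `L ≤ L'`: the Gram matrices of a bilinear form
satisfy `|det Gram_L| = [L' : L]² · |det Gram_{L'}|`. [folklore] -/
theorem abs_det_toMatrix_eq_relIndex_sq_mul {L L' : Submodule ℤ B} (hL : IsFullLattice B L)
    (hL' : IsFullLattice B L') (hle : L ≤ L') (T : LinearMap.BilinForm ℚ B)
    (b : Module.Basis (Fin 4) ℤ L) (b' : Module.Basis (Fin 4) ℤ L') :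
    |(Matrix.of fun i j => T (b i : B) (b j : B)).det| =
      (L.toAddSubgroup.relIndex L'.toAddSubgroup : ℚ) ^ 2 *
        |(Matrix.of fun i j => T (b' i : B) (b' j : B)).det| := by
  classical
  haveI : IsAddTorsionFree B := isAddTorsionFree_of_charZero_module ℚ B
  haveI := isLocalizedModule_subtype_of_isFullLattice hL
  haveI := isLocalizedModule_subtype_of_isFullLattice hL'
  let bQ : Module.Basis (Fin 4) ℚ B := b.ofIsLocalizedModule ℚ (nonZeroDivisors ℤ) L.subtype
  let bQ' : Module.Basis (Fin 4) ℚ B := b'.ofIsLocalizedModule ℚ (nonZeroDivisors ℤ) L'.subtype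
  have hbQ : ∀ k, bQ k = (b k : B) := fun k => Module.Basis.ofIsLocalizedModule_apply _ _ _ _ k
  have hbQ' : ∀ k, bQ' k = (b' k : B) := fun k => Module.Basis.ofIsLocalizedModule_apply _ _ _ _ k
  -- the index as a determinant
  have h1 : L.toAddSubgroup = AddSubgroup.closure (Set.range bQ) := by
    rw [eq_span_range_basis b, Submodule.span_int_eq_addSubgroupClosure]
    congr 1; ext x; simp [hbQ]
  have h2 : L'.toAddSubgroup = AddSubgroup.closure (Set.range bQ') := by
    rw [eq_span_range_basis b', Submodule.span_int_eq_addSubgroupClosure]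
    congr 1; ext x; simp [hbQ']
  have hidx := AddSubgroup.relIndex_eq_abs_det L.toAddSubgroup L'.toAddSubgroup
    (Submodule.toAddSubgroup_mono hle) bQ bQ' h1 h2
  -- the Gram matrices
  have hG : (Matrix.of fun i j => T (b i : B) (b j : B)) = LinearMap.BilinForm.toMatrix bQ T := by
    ext i j; rw [LinearMap.BilinForm.toMatrix_apply, hbQ, hbQ, Matrix.of_apply]
  have hG' : (Matrix.of fun i j => T (b' i : B) (b' j : B)) = LinearMap.BilinForm.toMatrix bQ' T := by
    ext i j; rw [LinearMap.BilinForm.toMatrix_apply, hbQ', hbQ', Matrix.of_apply]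
  rw [hG, hG', hidx, ← LinearMap.BilinForm.toMatrix_mul_basis_toMatrix bQ' bQ T, Matrix.det_mul,
    Matrix.det_mul, Matrix.det_transpose, Module.Basis.det_apply, abs_mul, abs_mul]
  ring

/-- **`|det (trd(b_i b̄_j))| = (D M)²` for a `ℤ`-basis `b` of an Eichler order of level `M`** in a
division quaternion algebra of discriminant `D` (`d(O) = D M`: Vignéras III §5, after Cor. 5.3;
Voight 23.4.19 `discrd O = D M`). [cite: VignerasLNM800, Ch. III §5 (niveau, discriminant réduit)] -/
theorem abs_det_traceMatrix_eq_of_isEichlerOrder (hdiv : ∀ x : B, x ≠ 0 → IsUnit x) {D M : ℕ}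
    (hsq : Squarefree D)
    (hram : ∀ v : HeightOneSpectrum (𝓞 ℚ), v ∈ ramifiedPlaces ℚ B ↔ ((D : ℕ) : 𝓞 ℚ) ∈ v.asIdeal)
    {O : Submodule ℤ B} (hO : IsEichlerOrder O M) (b : Module.Basis (Fin 4) ℤ O) :
    |(Matrix.of fun i j => reducedTrace ℚ B ((b i : B) * standardInvolution ℚ B (b j : B))).det| =
      ((D * M : ℕ) : ℚ) ^ 2 := by
  obtain ⟨O₁, O₂, hO₁, hO₂, hOeq, hidx⟩ := hO
  have hOord : IsZOrder O := hOeq ▸ hO₁.1.inf hO₂.1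
  have hle : O ≤ O₁ := hOeq ▸ inf_le_left
  obtain ⟨b₁⟩ := hO₁.1.isFullLattice.nonempty_basis_fin_four
  obtain ⟨T, hT⟩ := exists_bilinForm_trace_conj (B := B)
  have h := abs_det_toMatrix_eq_relIndex_sq_mul hOord.isFullLattice hO₁.1.isFullLattice hle T b b₁
  simp only [hT] at h
  rw [h, hidx, abs_det_traceMatrix_eq_of_isMaximalZOrder hdiv hsq hram hO₁ b₁]
  push_cast
  ring

/-! ### 4. The real side: `|det P|² = |det (trd(b_i b̄_j))|` for the entry matrix `P` of `ι ∘ b` -/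

/-- **The form `β(X, Y) = tr X tr Y - tr(X Y)` on `2 × 2` matrices is a perfect pairing of
determinant `±1` on the matrix units**: with `x_k, y_k` the entries of `X, Y`,
`β(X, Y) = x₀₀ y₁₁ + x₁₁ y₀₀ - x₀₁ y₁₀ - x₁₀ y₀₁`, so that for any family `v : ι → M₂(R)` indexed by
`ι = Fin 2 × Fin 2` the Gram matrix `(β(v i, v j))` equals `P G₀ Pᵀ` with `P i k = (v i)_k`,
`G₀² = 1`; hence `(det (β(v i, v j)))² = (det P)⁴`, stated as `|det Gram| = (det P)²`. [folklore] -/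
theorem abs_det_gram_traceForm_eq_det_entries_sq {R : Type*} [CommRing R] [LinearOrder R]
    [IsStrictOrderedRing R] (v : Fin 2 × Fin 2 → Matrix (Fin 2) (Fin 2) R) :
    |(Matrix.of fun i j => (v i).trace * (v j).trace - (v i * v j).trace).det| =
      (Matrix.of fun i k : Fin 2 × Fin 2 => v i k.1 k.2).det ^ 2 := by
  -- the Gram matrix of `β` on the matrix units
  let G₀ : Matrix (Fin 2 × Fin 2) (Fin 2 × Fin 2) R := Matrix.of fun k l =>
    (if k.1 = k.2 then (1:R) else 0) * (if l.1 = l.2 then 1 else 0) -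
      (if k.2 = l.1 then (1:R) else 0) * (if k.1 = l.2 then 1 else 0)
  set P : Matrix (Fin 2 × Fin 2) (Fin 2 × Fin 2) R := Matrix.of fun i k => v i k.1 k.2 with hP
  have hβ : ∀ X Y : Matrix (Fin 2) (Fin 2) R, X.trace * Y.trace - (X * Y).trace =
      ∑ l : Fin 2 × Fin 2, ∑ k : Fin 2 × Fin 2, X k.1 k.2 * G₀ k l * Y l.1 l.2 := by
    intro X Y
    simp only [Matrix.trace_fin_two, Matrix.mul_apply, Fin.sum_univ_two, Fintype.sum_prod_type,
      G₀, Matrix.of_apply, Fin.isValue]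
    simp
    ring
  have hGram : (Matrix.of fun i j => (v i).trace * (v j).trace - (v i * v j).trace) =
      P * G₀ * P.transpose := by
    ext i j
    rw [Matrix.of_apply, hβ, Matrix.mul_apply]
    refine Finset.sum_congr rfl fun l _ => ?_
    rw [Matrix.mul_apply, Finset.sum_mul, Matrix.transpose_apply]
    refine Finset.sum_congr rfl fun k _ => ?_
    simp only [hP, Matrix.of_apply]
  have hG₀ : G₀ * G₀ = 1 := by
    ext ⟨a, b⟩ ⟨c, d⟩
    simp only [Matrix.mul_apply, Fintype.sum_prod_type, Fin.sum_univ_two, G₀, Matrix.of_apply,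
      Matrix.one_apply, Prod.mk.injEq, Fin.isValue]
    fin_cases a <;> fin_cases b <;> fin_cases c <;> fin_cases d <;> simp
  have hdetG₀ : |G₀.det| = 1 := by
    have h : G₀.det * G₀.det = 1 := by rw [← Matrix.det_mul, hG₀, Matrix.det_one]
    rcases mul_self_eq_one_iff.mp h with h1 | h1
    · rw [h1, abs_one]
    · rw [h1, abs_neg, abs_one]
  rw [hGram, Matrix.det_mul, Matrix.det_mul, Matrix.det_transpose, abs_mul, abs_mul, hdetG₀,
    mul_one, ← abs_mul, abs_mul_self, sq]


/-! ### 5. `covol ι(O) = D M` for a Shimura curve datum with `D > 1` -/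

namespace ShimuraCurveData

variable {D M : ℕ} (X : ShimuraCurveData D M)

/-- The ramification clause of a Shimura curve datum in the "`(D) ⊆ v`" form used by the local
theory (`primesEquiv_dvd_iff`). [folklore] -/
theorem mem_ramifiedPlaces_iff (v : HeightOneSpectrum (𝓞 ℚ)) :
    v ∈ ramifiedPlaces ℚ X.B ↔ ((D : ℕ) : 𝓞 ℚ) ∈ v.asIdeal := by
  rw [X.ramifiedPlaces_eq, Set.mem_setOf_eq, primesEquiv_dvd_iff]

/-- `trd(x ȳ) = trd(x) trd(y) - trd(x y)` (`ȳ = trd(y) - y`). [cite: VignerasLNM800, Ch. I §1 Lemme 1.1] -/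
theorem reducedTrace_mul_standardInvolution (x y : X.B) :
    reducedTrace ℚ X.B (x * standardInvolution ℚ X.B y) =
      reducedTrace ℚ X.B x * reducedTrace ℚ X.B y - reducedTrace ℚ X.B (x * y) := by
  rw [standardInvolution, mul_sub, map_sub, ← Algebra.commutes, ← Algebra.smul_def, map_smul,
    smul_eq_mul, mul_comm]

/-- Through the real splitting: `trd(x ȳ) = tr ι(x) tr ι(y) - tr(ι(x) ι(y))` in `ℝ`
(`AlgHom.trace_eq_reducedTrace`). [folklore] -/
theorem algebraMap_reducedTrace_mul_standardInvolution (x y : X.B) :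
    algebraMap ℚ ℝ (reducedTrace ℚ X.B (x * standardInvolution ℚ X.B y)) =
      (X.ι x).trace * (X.ι y).trace - (X.ι x * X.ι y).trace := by
  rw [X.reducedTrace_mul_standardInvolution, map_sub, map_mul, ← AlgHom.trace_eq_reducedTrace X.ι,
    ← AlgHom.trace_eq_reducedTrace X.ι, ← AlgHom.trace_eq_reducedTrace X.ι, map_mul]

/-- **`covol ι(O) = D · M`.** For a Shimura curve datum of level `(D, M)` whose algebra is a
division algebra (e.g. `1 < D`, `ShimuraCurveData.isUnit_of_ne_zero`) and any
`ℤ`-basis `b` of the Eichler order `O` indexed by `Fin 2 × Fin 2`, the matrix of entries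
`P i k = ι(b i)_{k}` has `|det P| = D M`: the lattice `ι(O) ⊆ M₂(ℝ) ≅ ℝ⁴` has covolume `D M` for
the Lebesgue measure of the entries (reduced discriminant of an Eichler order of level `M` in the
quaternion algebra of discriminant `D`, Vignéras III §5; through `tr(ι x · adj ι y) = trd(x ȳ)`).
[cite: VignerasLNM800, Ch. III §5 Cor. 5.3 (discriminant réduit, niveau), Ch. IV §1] -/
theorem abs_det_entries_eq (hdiv : ∀ x : X.B, x ≠ 0 → IsUnit x)
    (b : Module.Basis (Fin 2 × Fin 2) ℤ X.O) :
    |(Matrix.of fun i k : Fin 2 × Fin 2 => X.ι (b i : X.B) k.1 k.2).det| = ((D * M : ℕ) : ℝ) := by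
  have hO : IsEichlerOrder X.O M := isEichlerOrder_iff_brandt.mpr X.isEichlerOrder
  -- the rational Gram determinant, through a `Fin 4`-indexed copy of `b`
  let b4 : Module.Basis (Fin 4) ℤ X.O := b.reindex finProdFinEquiv
  have h4 := abs_det_traceMatrix_eq_of_isEichlerOrder hdiv X.squarefree X.mem_ramifiedPlaces_iff hO b4
  have hre : (Matrix.of fun i j : Fin 2 × Fin 2 =>
      reducedTrace ℚ X.B ((b i : X.B) * standardInvolution ℚ X.B (b j : X.B))) =
      Matrix.reindex finProdFinEquiv.symm finProdFinEquiv.symm (Matrix.of fun i j : Fin 4 =>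
        reducedTrace ℚ X.B ((b4 i : X.B) * standardInvolution ℚ X.B (b4 j : X.B))) := by
    ext i j
    simp [b4]
  have hQ : |(Matrix.of fun i j : Fin 2 × Fin 2 =>
      reducedTrace ℚ X.B ((b i : X.B) * standardInvolution ℚ X.B (b j : X.B))).det| =
      ((D * M : ℕ) : ℚ) ^ 2 := by
    rw [hre, Matrix.det_reindex_self, h4]
  -- to `ℝ`
  have hR : |(Matrix.of fun i j : Fin 2 × Fin 2 =>
      (X.ι (b i : X.B)).trace * (X.ι (b j : X.B)).trace - (X.ι (b i : X.B) * X.ι (b j : X.B)).trace).det| =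
      ((D * M : ℕ) : ℝ) ^ 2 := by
    have hmap : (Matrix.of fun i j : Fin 2 × Fin 2 =>
        (X.ι (b i : X.B)).trace * (X.ι (b j : X.B)).trace - (X.ι (b i : X.B) * X.ι (b j : X.B)).trace) =
        (algebraMap ℚ ℝ).mapMatrix (Matrix.of fun i j : Fin 2 × Fin 2 =>
          reducedTrace ℚ X.B ((b i : X.B) * standardInvolution ℚ X.B (b j : X.B))) := by
      ext i j
      simp only [RingHom.mapMatrix_apply, Matrix.map_apply, Matrix.of_apply,
        X.algebraMap_reducedTrace_mul_standardInvolution]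
    rw [hmap, ← RingHom.map_det, eq_ratCast, ← Rat.cast_abs, hQ]
    push_cast
    ring
  rw [abs_det_gram_traceForm_eq_det_entries_sq] at hR
  have := (sq_eq_sq_iff_abs_eq_abs _ _).mp hR
  rwa [abs_of_nonneg (by positivity : (0:ℝ) ≤ ((D * M : ℕ) : ℝ))] at this

end ShimuraCurveData

end Literature.NumberTheory.Automorphic

end
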